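import Summits.ValiantsHypothesis.ValiantsHypothesis.Theses.ImmanantSlice
import Summits.ValiantsHypothesis.ValiantsHypothesis.Theorems.DetqpThesis.Negative.IffPerNotVQP
import Literature.Computability.AlgebraicComplexity.PermanentVsDeterminant
import Literature.Computability.AlgebraicComplexity.DeterminantalComplexityProofs

/-!
# `ImmanantSlice.DeterminantalRigidity` (stmt-ValiantsHypothesis-4213) — where the item sits

The support item `DeterminantalRigidity` (DR) is the `VBP`/`dc` special case of the route target
`CuspidalRigidity` (CR): every p-family of CLASS FUNCTIONS `χ_n : S_n → ℂ` whose generalized matrix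
functions `d_χ = ∑_σ χ(σ) ∏ᵢ x_{σ(i), i}` have p-bounded affine determinantal complexity is, for some
`k` and all large `n`, a scalar multiple of `sgn` on `Π_k(n)` (fixed-point-free permutations all of
whose cycles are longer than `k`).  This file pins the item between two statements of the tree:

* `determinantalRigidity_of_cuspidalRigidity` : `CR → DR` — p-bounded `dc` makes `(d_{χ_n})` a `VP`
  family (`isVPFamily_of_isPBounded_determinantalComplexity`: `n²` variables, `deg ≤ dc`,
  `L ≤ 8(dc+1)⁷ + dc²(2n²+1)` by `DET ∈ VP`, tree `complexity_le_of_determinantalComplexity`);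
* `dcPerSuperpolynomial_of_determinantalRigidity` : `DR → DcPerSuperpolynomial ℂ` — with `χ ≡ 1`,
  `d_χ = per_n`, and the trivial class function is not sign-like on `Π_k(n)` for `n ≥ 2k + 4`
  (an `n`-cycle and a product of two long cycles have opposite signs), so DR implies Valiant's
  hypothesis in determinantal-complexity form (`Literature…PermanentVsDeterminant`,
  `DcPerSuperpolynomialComplex`, Landsberg 2017 Conj. 1.2.4.2, status OPEN).

So the item, as filed, is at least as strong as the permanent-versus-determinant conjecture and at
most as strong as the route target; it cannot be closed `proved` short of `VBP ≠ VNP` over `ℂ`.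
The contrapositive `not_isPBounded_dc_of_determinantalRigidity` is the dc-form KILL SWITCH of the
route: any class-function family violating sign-likeness infinitely often and having p-bounded `dc`
refutes DR (hence CR); `not_isPBounded_dc_evenCycleCover_of_determinantalRigidity` records the
instance for the route's prime suspect `D^even_n = ∑_{σ fpf, all cycles even} sgn(σ) x^σ`.
Elementary; no new definitions, no named facts.
-/

noncomputable section

namespace Summit.ValiantsHypothesis.Theorems.DeterminantalRigidityReductions

open MvPolynomial Literature.Computability.AlgebraicComplexity
open Summit.ValiantsHypothesis.ValiantsHypothesis.Theses.ImmanantSlice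

/-! ### Permutations of a given cycle type: fixed points and signs -/

/-- A permutation of `Fin n` whose cycle type sums to `n` has no fixed point
(`∑ cycleType = #support`). [folklore] -/
theorem ne_self_of_sum_cycleType {n : ℕ} {σ : Equiv.Perm (Fin n)} (h : σ.cycleType.sum = n)
    (i : Fin n) : σ i ≠ i := by
  have hsupp : σ.support = Finset.univ := by
    apply Finset.eq_univ_of_card
    rw [← Equiv.Perm.sum_cycleType, h, Fintype.card_fin]
  exact Equiv.Perm.mem_support.1 (hsupp ▸ Finset.mem_univ i)

/-- An `(a + b)`-cycle and a permutation of type `(a, b)` have opposite signs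
(`sgn = (-1)^(∑ cycleType + #cycleType)`). [folklore] -/
theorem sign_eq_neg_sign_of_cycleType {a b : ℕ} {σ τ : Equiv.Perm (Fin (a + b))}
    (hσ : σ.cycleType = {a + b}) (hτ : τ.cycleType = {a, b}) :
    Equiv.Perm.sign τ = -Equiv.Perm.sign σ := by
  rw [Equiv.Perm.sign_of_cycleType, Equiv.Perm.sign_of_cycleType, hσ, hτ]
  simp only [Multiset.insert_eq_cons, Multiset.sum_cons, Multiset.sum_singleton,
    Multiset.card_cons, Multiset.card_singleton]
  rw [show a + b + (1 + 1) = (a + b + 1) + 1 by ring, pow_succ _ (a + b + 1), mul_neg_one]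

/-- For `a, b ≥ 2` there are an `(a + b)`-cycle `σ` and a permutation `τ` of type `(a, b)` on
`Fin (a + b)` (`Equiv.Perm.exists_with_cycleType_iff`). [folklore] -/
theorem exists_cycle_and_pair {a b : ℕ} (ha : 2 ≤ a) (hb : 2 ≤ b) :
    ∃ σ τ : Equiv.Perm (Fin (a + b)), σ.cycleType = {a + b} ∧ τ.cycleType = {a, b} := by
  obtain ⟨σ, hσ⟩ : ∃ σ : Equiv.Perm (Fin (a + b)), σ.cycleType = {a + b} :=
    (Equiv.Perm.exists_with_cycleType_iff (Fin (a + b))).2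
      ⟨by simp, by simp only [Multiset.mem_singleton, forall_eq]; omega⟩
  obtain ⟨τ, hτ⟩ : ∃ τ : Equiv.Perm (Fin (a + b)), τ.cycleType = {a, b} :=
    (Equiv.Perm.exists_with_cycleType_iff (Fin (a + b))).2
      ⟨by simp only [Multiset.insert_eq_cons, Multiset.sum_cons, Multiset.sum_singleton,
            Fintype.card_fin]; omega,
       by simp only [Multiset.insert_eq_cons, Multiset.mem_cons, Multiset.mem_singleton]
          rintro c (rfl | rfl) <;> omega⟩
  exact ⟨σ, τ, hσ, hτ⟩

/-! ### The contrapositive (kill-switch) form of `DeterminantalRigidity` -/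

/-- **dc-form kill switch.** Under `DeterminantalRigidity`, a class-function family that violates
sign-likeness on long cycles infinitely often (for every `k, n₀` some `n ≥ n₀` at which `χ_n|Π_k(n)`
is no scalar multiple of `sgn` — verbatim the hypothesis of the route's `PermanentDominance`) has
generalized matrix functions of NON-p-bounded determinantal complexity. [folklore] -/
theorem not_isPBounded_dc_of_determinantalRigidity (hDR : DeterminantalRigidity)
    (χ : (n : ℕ) → Equiv.Perm (Fin n) → ℂ)
    (hχ : ∀ n (σ τ : Equiv.Perm (Fin n)), IsConj σ τ → χ n σ = χ n τ)
    (hviol : ∀ k n₀ : ℕ, ∃ n, n₀ ≤ n ∧ ∀ c : ℂ, ∃ σ : Equiv.Perm (Fin n), (∀ i, σ i ≠ i) ∧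
      (∀ m ∈ σ.cycleType, k < m) ∧ χ n σ ≠ c * ((Equiv.Perm.sign σ : ℤ) : ℂ)) :
    ¬ IsPBounded (fun n => determinantalComplexity
      (∑ σ : Equiv.Perm (Fin n), C (χ n σ) * ∏ i : Fin n, X (σ i, i))) := by
  intro hB
  obtain ⟨k, n₀, hk⟩ := hDR χ hχ hB
  obtain ⟨n, hn, hv⟩ := hviol k n₀
  obtain ⟨c, hc⟩ := hk n hn
  obtain ⟨σ, h1, h2, h3⟩ := hv c
  exact h3 (hc σ h1 h2)

/-! ### `DR ⟹` Valiant's hypothesis in dc form -/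

/-- The trivial class function `χ ≡ 1` (whose `d_χ` is the permanent) violates sign-likeness on
`Π_k(n)` at every `n ≥ 2k + 4`: an `n`-cycle and a permutation of type `(k + 2, n - k - 2)` both lie
in `Π_k(n)` and have opposite signs, so `1 = c · sgn` fails for one of them. [folklore] -/
theorem one_not_signLike (k n₀ : ℕ) :
    ∃ n, n₀ ≤ n ∧ ∀ c : ℂ, ∃ σ : Equiv.Perm (Fin n), (∀ i, σ i ≠ i) ∧
      (∀ m ∈ σ.cycleType, k < m) ∧ (1 : ℂ) ≠ c * ((Equiv.Perm.sign σ : ℤ) : ℂ) := by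
  obtain ⟨σ, τ, hσ, hτ⟩ := exists_cycle_and_pair (a := k + 2) (b := n₀ + k + 2) (by omega) (by omega)
  have hsign := sign_eq_neg_sign_of_cycleType hσ hτ
  refine ⟨k + 2 + (n₀ + k + 2), by omega, fun c => ?_⟩
  have hσfpf : ∀ i, σ i ≠ i := ne_self_of_sum_cycleType (by rw [hσ]; simp)
  have hτfpf : ∀ i, τ i ≠ i :=
    ne_self_of_sum_cycleType (by rw [hτ]; simp [Multiset.insert_eq_cons])
  have hσlong : ∀ m ∈ σ.cycleType, k < m := fun m hm => by
    rw [hσ, Multiset.mem_singleton] at hm; omega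
  have hτlong : ∀ m ∈ τ.cycleType, k < m := fun m hm => by
    rw [hτ] at hm
    simp only [Multiset.insert_eq_cons, Multiset.mem_cons, Multiset.mem_singleton] at hm
    rcases hm with rfl | rfl <;> omega
  by_cases hc : (1 : ℂ) = c * ((Equiv.Perm.sign σ : ℤ) : ℂ)
  · refine ⟨τ, hτfpf, hτlong, fun hc' => ?_⟩
    rw [hsign, Units.val_neg, Int.cast_neg, mul_neg, ← hc] at hc'
    norm_num at hc'
  · exact ⟨σ, hσfpf, hσlong, hc⟩

/-- `d_1 = per_n`: the generalized matrix function of the trivial class function is the generic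
permanent `perPoly (Fin n) ℂ` (Bürgisser 2000, (2.2)). [folklore] -/
theorem sum_C_one_mul_prod_eq_perPoly (n : ℕ) :
    (∑ σ : Equiv.Perm (Fin n), C (1 : ℂ) * ∏ i : Fin n, X (σ i, i)) = perPoly (Fin n) ℂ := by
  simp [perPoly, Matrix.permanent, Matrix.mvPolynomialX]

/-- **`DeterminantalRigidity` implies the permanent-versus-determinant conjecture over `ℂ`**
(`DcPerSuperpolynomial ℂ`, i.e. `dc(per_n)` is not p-bounded — Valiant 1979; Landsberg 2017,
Conj. 1.2.4.2; registered OPEN in `Literature…PermanentVsDeterminant`): apply the kill-switch form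
to `χ ≡ 1`. Hence the item cannot be closed `proved` without separating `VBP` from `VNP`.
[folklore] -/
theorem dcPerSuperpolynomial_of_determinantalRigidity (hDR : DeterminantalRigidity) :
    DcPerSuperpolynomial ℂ := by
  have h := not_isPBounded_dc_of_determinantalRigidity hDR (fun _ _ => 1) (fun _ _ _ _ => rfl)
    one_not_signLike
  have hfun : (fun n => determinantalComplexity
      (∑ σ : Equiv.Perm (Fin n), C ((fun (_ : ℕ) (_ : Equiv.Perm (Fin _)) => (1 : ℂ)) n σ) *
        ∏ i : Fin n, X (σ i, i))) =
      fun n => determinantalComplexity (perPoly (Fin n) ℂ) :=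
    funext fun n => congrArg determinantalComplexity (sum_C_one_mul_prod_eq_perPoly n)
  rw [hfun] at h
  exact h

/-- The same, spelled as the tree's registered open statement `DcPerSuperpolynomialComplex`
(Landsberg 2017, Conj. 1.2.4.2). [folklore] -/
theorem dcPerSuperpolynomialComplex_of_determinantalRigidity (hDR : DeterminantalRigidity) :
    DcPerSuperpolynomialComplex :=
  dcPerSuperpolynomial_of_determinantalRigidity hDR

/-! ### The even-cycle-cover family: the route's kill switch in dc form -/

/-- Fixed-point-freeness is read off the cycle type: `σ` has no fixed point iff its cycle type sums
to `n` (`∑ cycleType = #support`). [folklore] -/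
theorem forall_ne_self_iff_sum_cycleType {n : ℕ} (σ : Equiv.Perm (Fin n)) :
    (∀ i, σ i ≠ i) ↔ σ.cycleType.sum = n := by
  refine ⟨fun h => ?_, fun h => ne_self_of_sum_cycleType h⟩
  have hsupp : σ.support = Finset.univ :=
    Finset.eq_univ_iff_forall.2 fun i => Equiv.Perm.mem_support.2 (h i)
  rw [Equiv.Perm.sum_cycleType, hsupp, Finset.card_univ, Fintype.card_fin]

/-- The coefficient function of the signed even-cycle-cover family `D^even`,
`χ(σ) = sgn σ · [σ fixed-point-free with all cycles even]`, is a class function (it factors through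
the cycle type, `Equiv.Perm.isConj_iff_cycleType_eq`). [folklore] -/
theorem evenCycleChar_isConj (n : ℕ) (σ τ : Equiv.Perm (Fin n)) (h : IsConj σ τ) :
    (if (∀ i, σ i ≠ i) ∧ (∀ m ∈ σ.cycleType, Even m) then (((Equiv.Perm.sign σ : ℤ) : ℂ)) else 0) =
      (if (∀ i, τ i ≠ i) ∧ (∀ m ∈ τ.cycleType, Even m) then (((Equiv.Perm.sign τ : ℤ) : ℂ)) else 0) := by
  have hct : σ.cycleType = τ.cycleType := Equiv.Perm.isConj_iff_cycleType_eq.1 h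
  have hsign : Equiv.Perm.sign σ = Equiv.Perm.sign τ := by
    rw [Equiv.Perm.sign_of_cycleType, Equiv.Perm.sign_of_cycleType, hct]
  have hfpf : (∀ i, σ i ≠ i) ↔ (∀ i, τ i ≠ i) := by
    rw [forall_ne_self_iff_sum_cycleType, forall_ne_self_iff_sum_cycleType, hct]
  by_cases hσc : (∀ i, σ i ≠ i) ∧ ∀ m ∈ σ.cycleType, Even m
  · have hτc : (∀ i, τ i ≠ i) ∧ ∀ m ∈ τ.cycleType, Even m := ⟨hfpf.1 hσc.1, hct ▸ hσc.2⟩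
    rw [if_pos hσc, if_pos hτc, hsign]
  · have hτc : ¬ ((∀ i, τ i ≠ i) ∧ ∀ m ∈ τ.cycleType, Even m) := fun h' =>
      hσc ⟨hfpf.2 h'.1, fun m hm => h'.2 m (hct ▸ hm)⟩
    rw [if_neg hσc, if_neg hτc]

/-- `D^even` violates sign-likeness at every even `n ≥ 2k + 6`: with `a = 2k + 3`, `b = n - a` odd,
the `n`-cycle has `χ = sgn` while a permutation of type `(a, b)` (two long ODD cycles) has `χ = 0`,
and no single scalar `c` fits both. [folklore] -/
theorem evenCycleChar_not_signLike (k n₀ : ℕ) :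
    ∃ n, n₀ ≤ n ∧ ∀ c : ℂ, ∃ σ : Equiv.Perm (Fin n), (∀ i, σ i ≠ i) ∧
      (∀ m ∈ σ.cycleType, k < m) ∧
      (if (∀ i, σ i ≠ i) ∧ (∀ m ∈ σ.cycleType, Even m) then (((Equiv.Perm.sign σ : ℤ) : ℂ)) else 0) ≠
        c * ((Equiv.Perm.sign σ : ℤ) : ℂ) := by
  obtain ⟨σ, τ, hσ, hτ⟩ :=
    exists_cycle_and_pair (a := 2 * k + 3) (b := 2 * n₀ + 2 * k + 3) (by omega) (by omega)
  refine ⟨2 * k + 3 + (2 * n₀ + 2 * k + 3), by omega, fun c => ?_⟩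
  have hσfpf : ∀ i, σ i ≠ i := ne_self_of_sum_cycleType (by rw [hσ]; simp)
  have hτfpf : ∀ i, τ i ≠ i :=
    ne_self_of_sum_cycleType (by rw [hτ]; simp [Multiset.insert_eq_cons])
  have hσlong : ∀ m ∈ σ.cycleType, k < m := fun m hm => by
    rw [hσ, Multiset.mem_singleton] at hm; omega
  have hτlong : ∀ m ∈ τ.cycleType, k < m := fun m hm => by
    rw [hτ] at hm
    simp only [Multiset.insert_eq_cons, Multiset.mem_cons, Multiset.mem_singleton] at hm
    rcases hm with rfl | rfl <;> omega
  have hσeven : (∀ i, σ i ≠ i) ∧ ∀ m ∈ σ.cycleType, Even m := by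
    refine ⟨hσfpf, fun m hm => ?_⟩
    rw [hσ, Multiset.mem_singleton] at hm
    exact ⟨2 * k + 3 + n₀, by omega⟩
  have hτodd : ¬ ((∀ i, τ i ≠ i) ∧ ∀ m ∈ τ.cycleType, Even m) := fun h => by
    have h3 : Even (2 * k + 3) := h.2 _ (by rw [hτ]; simp)
    rcases h3 with ⟨r, hr⟩
    omega
  by_cases hc : c = 1
  · subst hc
    refine ⟨τ, hτfpf, hτlong, ?_⟩
    rw [if_neg hτodd, one_mul]
    rcases Int.units_eq_one_or (Equiv.Perm.sign τ) with h1 | h1 <;> rw [h1] <;> norm_num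
  · refine ⟨σ, hσfpf, hσlong, fun h => hc ?_⟩
    rw [if_pos hσeven] at h
    have hs : ((Equiv.Perm.sign σ : ℤ) : ℂ) ≠ 0 := Int.cast_ne_zero.2 (Units.ne_zero _)
    exact (mul_right_cancel₀ hs ((one_mul _).trans h)).symm

/-- **Kill switch, dc form, for the prime suspect.** Under `DeterminantalRigidity` the signed
even-cycle-cover family `D^even_n = ∑_{σ fpf, all cycles even} sgn(σ) ∏ᵢ x_{σ(i),i}` (the polynomial of
the route's `EvenCycleDominance` / `EvenCycleCoverNotVP`) has non-p-bounded determinantal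
complexity; contrapositively, p-bounded `dc(D^even_n)` refutes the item (and the route target).
[folklore] -/
theorem not_isPBounded_dc_evenCycleCover_of_determinantalRigidity (hDR : DeterminantalRigidity) :
    ¬ IsPBounded (fun n => determinantalComplexity (∑ σ : Equiv.Perm (Fin n),
      C (if (∀ i, σ i ≠ i) ∧ (∀ m ∈ σ.cycleType, Even m) then (((Equiv.Perm.sign σ : ℤ) : ℂ))
        else 0) * ∏ i : Fin n, X (σ i, i))) :=
  not_isPBounded_dc_of_determinantalRigidity hDR
    (fun _ σ => if (∀ i, σ i ≠ i) ∧ (∀ m ∈ σ.cycleType, Even m) then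
      (((Equiv.Perm.sign σ : ℤ) : ℂ)) else 0)
    evenCycleChar_isConj evenCycleChar_not_signLike

/-! ### The signed cycle-count family `T_n`: the route's second test, dc form -/

/-- The number of fixed points is read off the cycle type: `#{i | σ i = i} = n - ∑ cycleType`.
[folklore] -/
theorem card_fixedPoints_eq {n : ℕ} (σ : Equiv.Perm (Fin n)) :
    (Finset.univ.filter fun i : Fin n => σ i = i).card = n - σ.cycleType.sum := by
  rw [Equiv.Perm.sum_cycleType]
  have h : (Finset.univ.filter fun i : Fin n => σ i = i) = σ.supportᶜ := by
    ext i
    simp [Equiv.Perm.mem_support]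
  rw [h, Finset.card_compl, Fintype.card_fin]

/-- The coefficient function of `T_n = ∑_σ sgn(σ) c(σ) x^σ` (`c` = number of cycles, fixed points
included; `T_n = ∂_u [z^{[n]}] det(I + ZX)^u |_{u=1}`), `χ(σ) = sgn σ · c(σ)`, is a class function.
[folklore] -/
theorem cycleCountChar_isConj (n : ℕ) (σ τ : Equiv.Perm (Fin n)) (h : IsConj σ τ) :
    ((Equiv.Perm.sign σ : ℤ) : ℂ) *
        ((Multiset.card σ.cycleType + (Finset.univ.filter fun i : Fin n => σ i = i).card : ℕ) : ℂ) =
      ((Equiv.Perm.sign τ : ℤ) : ℂ) *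
        ((Multiset.card τ.cycleType + (Finset.univ.filter fun i : Fin n => τ i = i).card : ℕ) : ℂ) := by
  have hct : σ.cycleType = τ.cycleType := Equiv.Perm.isConj_iff_cycleType_eq.1 h
  have hsign : Equiv.Perm.sign σ = Equiv.Perm.sign τ := by
    rw [Equiv.Perm.sign_of_cycleType, Equiv.Perm.sign_of_cycleType, hct]
  rw [card_fixedPoints_eq, card_fixedPoints_eq, hct, hsign]

/-- `T_n` violates sign-likeness at every `n ≥ 2k + 4`: on `Π_k(n)` its coefficient is `sgn σ` times
the number of cycles, which is `1` on an `n`-cycle and `2` on a product of two long cycles.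
[folklore] -/
theorem cycleCountChar_not_signLike (k n₀ : ℕ) :
    ∃ n, n₀ ≤ n ∧ ∀ c : ℂ, ∃ σ : Equiv.Perm (Fin n), (∀ i, σ i ≠ i) ∧
      (∀ m ∈ σ.cycleType, k < m) ∧
      ((Equiv.Perm.sign σ : ℤ) : ℂ) *
          ((Multiset.card σ.cycleType + (Finset.univ.filter fun i : Fin n => σ i = i).card : ℕ) : ℂ) ≠
        c * ((Equiv.Perm.sign σ : ℤ) : ℂ) := by
  obtain ⟨σ, τ, hσ, hτ⟩ := exists_cycle_and_pair (a := k + 2) (b := n₀ + k + 2) (by omega) (by omega)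
  refine ⟨k + 2 + (n₀ + k + 2), by omega, fun c => ?_⟩
  have hσsum : σ.cycleType.sum = k + 2 + (n₀ + k + 2) := by rw [hσ]; simp
  have hτsum : τ.cycleType.sum = k + 2 + (n₀ + k + 2) := by
    rw [hτ]; simp [Multiset.insert_eq_cons]
  have hσfpf : ∀ i, σ i ≠ i := ne_self_of_sum_cycleType hσsum
  have hτfpf : ∀ i, τ i ≠ i := ne_self_of_sum_cycleType hτsum
  have hσlong : ∀ m ∈ σ.cycleType, k < m := fun m hm => by
    rw [hσ, Multiset.mem_singleton] at hm; omega
  have hτlong : ∀ m ∈ τ.cycleType, k < m := fun m hm => by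
    rw [hτ] at hm
    simp only [Multiset.insert_eq_cons, Multiset.mem_cons, Multiset.mem_singleton] at hm
    rcases hm with rfl | rfl <;> omega
  have hσc : (Multiset.card σ.cycleType +
      (Finset.univ.filter fun i : Fin (k + 2 + (n₀ + k + 2)) => σ i = i).card : ℕ) = 1 := by
    rw [card_fixedPoints_eq, hσsum, hσ]; simp
  have hτc : (Multiset.card τ.cycleType +
      (Finset.univ.filter fun i : Fin (k + 2 + (n₀ + k + 2)) => τ i = i).card : ℕ) = 2 := by
    rw [card_fixedPoints_eq, hτsum, hτ]; simp
  by_cases hc : c = 1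
  · subst hc
    refine ⟨τ, hτfpf, hτlong, fun h => ?_⟩
    rw [hτc, one_mul] at h
    have hs : ((Equiv.Perm.sign τ : ℤ) : ℂ) ≠ 0 := Int.cast_ne_zero.2 (Units.ne_zero _)
    have h2 : ((2 : ℕ) : ℂ) = 1 := mul_left_cancel₀ hs ((h.trans (mul_one _).symm))
    norm_num at h2
  · refine ⟨σ, hσfpf, hσlong, fun h => hc ?_⟩
    rw [hσc, Nat.cast_one, mul_one] at h
    have hs : ((Equiv.Perm.sign σ : ℤ) : ℂ) ≠ 0 := Int.cast_ne_zero.2 (Units.ne_zero _)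
    exact (mul_right_cancel₀ hs ((one_mul _).trans h)).symm

/-- **Kill switch, dc form, for `T_n`.** Under `DeterminantalRigidity` the signed cycle-count family
`T_n = ∑_σ sgn(σ) c(σ) ∏ᵢ x_{σ(i),i}` has non-p-bounded determinantal complexity; contrapositively a
polynomial-size determinantal expression for `T_n` refutes the item (and `TwoClassRigidity`, the
values on the two test classes being `∓1` versus `±2`). [folklore] -/
theorem not_isPBounded_dc_cycleCount_of_determinantalRigidity (hDR : DeterminantalRigidity) :
    ¬ IsPBounded (fun n => determinantalComplexity (∑ σ : Equiv.Perm (Fin n),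
      C (((Equiv.Perm.sign σ : ℤ) : ℂ) *
        ((Multiset.card σ.cycleType + (Finset.univ.filter fun i : Fin n => σ i = i).card : ℕ) : ℂ)) *
        ∏ i : Fin n, X (σ i, i))) :=
  not_isPBounded_dc_of_determinantalRigidity hDR
    (fun n σ => ((Equiv.Perm.sign σ : ℤ) : ℂ) *
        ((Multiset.card σ.cycleType + (Finset.univ.filter fun i : Fin n => σ i = i).card : ℕ) : ℂ))
    cycleCountChar_isConj cycleCountChar_not_signLike

/-! ### `CR ⟹ DR`: p-bounded determinantal complexity gives a `VP` family -/

/-- **p-bounded `dc` ⇒ `VP`.** A family with p-bounded variable count and p-bounded affine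
determinantal complexity is a `VP` family: `deg fₙ ≤ dc fₙ` (`totalDegree_le_determinantalComplexity`)
and `L(fₙ) ≤ 8(dc fₙ + 1)⁷ + (dc fₙ)²(2·#vars + 1)` (`DET ∈ VP` by Berkowitz plus substitution of the
affine entries, tree `complexity_le_of_determinantalComplexity`) (Bürgisser 2000, §2.5:
`VP_ws ⊆ VP`). [folklore] -/
theorem isVPFamily_of_isPBounded_determinantalComplexity {k : Type*} [CommRing k]
    {ι : ℕ → Type*} [∀ n, Fintype (ι n)] {f : ∀ n, MvPolynomial (ι n) k}
    (hι : IsPBounded fun n => Fintype.card (ι n))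
    (h : IsPBounded fun n => determinantalComplexity (f n)) : IsVPFamily f := by
  refine ⟨⟨hι, h.mono fun n => totalDegree_le_determinantalComplexity_holds (f n)⟩, ?_⟩
  have h1 : IsPBounded fun n => determinantalComplexity (f n) + 1 :=
    IsPBounded.add_holds h (IsPBounded.const 1)
  have h3 : IsPBounded fun n => 8 * (determinantalComplexity (f n) + 1) ^ 7 :=
    IsPBounded.mul_holds (IsPBounded.const 8) (IsPBounded.pow_holds h1 7)
  have h5 : IsPBounded fun n => 2 * Fintype.card (ι n) + 1 :=
    IsPBounded.add_holds (IsPBounded.mul_holds (IsPBounded.const 2) hι) (IsPBounded.const 1)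
  have h7 : IsPBounded fun n =>
      determinantalComplexity (f n) ^ 2 * (2 * Fintype.card (ι n) + 1) :=
    IsPBounded.mul_holds (IsPBounded.pow_holds h 2) h5
  show IsPBounded fun n => complexity (f n)
  exact (IsPBounded.add_holds h3 h7).mono fun n =>
    Summit.ValiantsHypothesis.Theorems.DetqpThesis.Negative.complexity_le_of_determinantalComplexity
      (f n)

/-- **`CuspidalRigidity → DeterminantalRigidity`**: the item is the `VBP` special case of the route
target (`n²` variables; p-bounded `dc` ⇒ `VP` family). [folklore] -/
theorem determinantalRigidity_of_cuspidalRigidity (hCR : CuspidalRigidity) :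
    DeterminantalRigidity :=
  fun χ hχ hdc => hCR χ hχ (isVPFamily_of_isPBounded_determinantalComplexity
    ((IsPBounded.mul_holds IsPBounded.id IsPBounded.id).mono fun n => by simp) hdc)

end Summit.ValiantsHypothesis.Theorems.DeterminantalRigidityReductions
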